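import Mathlib
import Summits.Ventures.PercRepro2.A3CutGc
import Summits.Ventures.PercRepro2.A3CutLoop

/-!
# The (HCOV) moments of the cut vertex do not see the part: the induction step of p1's line
(blind cell PercRepro2, night-1 g32; proofs/NIGHT1-G32.md §6 (E4))

Every moment of p1's (HCOV) vocabulary at the cut vertex `x` is a `B`-side mass (A3CutLoop), so
`T₀`, `Gc(x)` and `R½(x)` are the same on `G` and on `G − P` (`T0_loopA`, `Gc_loopA`, `Rhalf_loopA`).
With `Gc_cut` (A3CutGc): **`HCov_cut_of_leafRow_loopA`** — (HCOV) and row 2′LEAF at `x` on the SMALLER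
instance `G − P` give (HCOV) at every `v` behind the cut on `G`.  Standard axioms.
-/

namespace Summit.Ventures.PercRepro2

open UnionCluster CovForm CutV

namespace CovForm

namespace A3Fibre

section GcLoop

variable {V : Type*} {E : Type*} [Fintype V] [DecidableEq V] [Fintype E] [DecidableEq E]
  {R : Type*} [Field R] [LinearOrder R] [IsStrictOrderedRing R] {ends : E → Sym2 V} {x : V}
  {VA VB : Finset V} {EA EB : Set E} [DecidablePred (· ∈ EA)] [DecidablePred (· ∈ EB)] {p : E → R}
  {o a₁ a₂ b : V}

omit [Fintype V] [Fintype E] [DecidableEq E] [Field R] [LinearOrder R] [IsStrictOrderedRing R]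
  [DecidablePred (· ∈ EA)] in
/-- `Q ∩ {r ↔ y} ∩ {r' ↔ y'}` is a `B`-side event. -/
lemma Qconn2_eq_sideEventB (h : IsCut ends x ↑VA ↑VB EA EB) (h1 : a₁ ∈ insert x VB)
    (h2 : a₂ ∈ insert x VB) {r y r' y' : V} (hr : r ∈ insert x VB) (hy : y ∈ insert x VB)
    (hr' : r' ∈ insert x VB) (hy' : y' ∈ insert x VB) :
    avoidAll ends a₂ {a₁} ∩ (connEvent ends r y ∩ connEvent ends r' y') =
      sideEvent EB (avoidAll ends a₂ {a₁} ∩ (connEvent ends r y ∩ connEvent ends r' y')) := by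
  conv_rhs => rw [← sideEvent_inter, ← sideEvent_inter, ← avoidAll_eq_sideEventB' h h1 h2,
    ← connEvent_eq_sideEventB' h hr hy, ← connEvent_eq_sideEventB' h hr' hy']

omit [Fintype V] [Fintype E] [DecidableEq E] [Field R] [LinearOrder R] [IsStrictOrderedRing R]
  [DecidablePred (· ∈ EA)] in
/-- `Q ∩ {s ↔ x} ∩ {r ↔ y} ∩ {r' ↔ y'}` is a `B`-side event. -/
lemma Qconn3_eq_sideEventB (h : IsCut ends x ↑VA ↑VB EA EB) (h1 : a₁ ∈ insert x VB)
    (h2 : a₂ ∈ insert x VB) {s r y r' y' : V} (hs : s ∈ insert x VB) (hr : r ∈ insert x VB)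
    (hy : y ∈ insert x VB) (hr' : r' ∈ insert x VB) (hy' : y' ∈ insert x VB) :
    avoidAll ends a₂ {a₁} ∩ (connEvent ends s x ∩ (connEvent ends r y ∩ connEvent ends r' y')) =
      sideEvent EB (avoidAll ends a₂ {a₁} ∩
        (connEvent ends s x ∩ (connEvent ends r y ∩ connEvent ends r' y'))) := by
  conv_rhs => rw [← sideEvent_inter, ← sideEvent_inter, ← sideEvent_inter,
    ← avoidAll_eq_sideEventB' h h1 h2, ← connEvent_eq_sideEventB' h hs (Finset.mem_insert_self x VB),
    ← connEvent_eq_sideEventB' h hr hy, ← connEvent_eq_sideEventB' h hr' hy']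

omit [Fintype V] [LinearOrder R] [IsStrictOrderedRing R] in
/-- `P(Q ∩ {r ↔ y} ∩ {r' ↔ y'})` on `G − P` (all four vertices in `VB ∪ {x}`). -/
lemma probQconn2_loopA (h : IsCut ends x ↑VA ↑VB EA EB) (h1 : a₁ ∈ insert x VB)
    (h2 : a₂ ∈ insert x VB) {r y r' y' : V} (hr : r ∈ insert x VB) (hy : y ∈ insert x VB)
    (hr' : r' ∈ insert x VB) (hy' : y' ∈ insert x VB) :
    prob p (avoidAll (loopA ends EA x) a₂ {a₁} ∩
        (connEvent (loopA ends EA x) r y ∩ connEvent (loopA ends EA x) r' y')) =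
      prob p (avoidAll ends a₂ {a₁} ∩ (connEvent ends r y ∩ connEvent ends r' y')) := by
  rw [avoidAll_loopA h, connEvent_loopA h, connEvent_loopA h, sideEvent_inter, sideEvent_inter,
    ← Qconn2_eq_sideEventB h h1 h2 hr hy hr' hy']

omit [Fintype V] [LinearOrder R] [IsStrictOrderedRing R] in
/-- `P(Q ∩ {s ↔ x} ∩ {r ↔ y} ∩ {r' ↔ y'})` on `G − P`. -/
lemma probQconn_x_conn2_loopA (h : IsCut ends x ↑VA ↑VB EA EB) (h1 : a₁ ∈ insert x VB)
    (h2 : a₂ ∈ insert x VB) {s r y r' y' : V} (hs : s ∈ insert x VB) (hr : r ∈ insert x VB)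
    (hy : y ∈ insert x VB) (hr' : r' ∈ insert x VB) (hy' : y' ∈ insert x VB) :
    prob p (avoidAll (loopA ends EA x) a₂ {a₁} ∩ (connEvent (loopA ends EA x) s x ∩
        (connEvent (loopA ends EA x) r y ∩ connEvent (loopA ends EA x) r' y'))) =
      prob p (avoidAll ends a₂ {a₁} ∩ (connEvent ends s x ∩ (connEvent ends r y ∩ connEvent ends r' y'))) := by
  rw [avoidAll_loopA h, connEvent_loopA h, connEvent_loopA h, connEvent_loopA h, sideEvent_inter,
    sideEvent_inter, sideEvent_inter, ← Qconn3_eq_sideEventB h h1 h2 hs hr hy hr' hy']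

omit [Fintype V] [LinearOrder R] [IsStrictOrderedRing R] in
/-- `P(T ∩ X)`-type masses on `G − P`: `P(Q ∩ {s ↔ x} ∩ {r ↔ y})`. -/
lemma probQconn_x_conn_loopA (h : IsCut ends x ↑VA ↑VB EA EB) (h1 : a₁ ∈ insert x VB)
    (h2 : a₂ ∈ insert x VB) {s r y : V} (hs : s ∈ insert x VB) (hr : r ∈ insert x VB)
    (hy : y ∈ insert x VB) :
    prob p (avoidAll (loopA ends EA x) a₂ {a₁} ∩
        (connEvent (loopA ends EA x) s x ∩ connEvent (loopA ends EA x) r y)) =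
      prob p (avoidAll ends a₂ {a₁} ∩ (connEvent ends s x ∩ connEvent ends r y)) :=
  probQconn2_loopA h h1 h2 hs (Finset.mem_insert_self x VB) hr hy

omit [Fintype V] in
/-- `P(PD_x ∩ {r ↔ y} ∩ {r' ↔ y'})` on `G − P`. -/
lemma probPDconn2_loopA (h : IsCut ends x ↑VA ↑VB EA EB) (h1 : a₁ ∈ insert x VB)
    (h2 : a₂ ∈ insert x VB) {r y r' y' : V} (hr : r ∈ insert x VB) (hy : y ∈ insert x VB)
    (hr' : r' ∈ insert x VB) (hy' : y' ∈ insert x VB) :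
    prob p (PDEvent (loopA ends EA x) a₁ a₂ x ∩
        (connEvent (loopA ends EA x) r y ∩ connEvent (loopA ends EA x) r' y')) =
      prob p (PDEvent ends a₁ a₂ x ∩ (connEvent ends r y ∩ connEvent ends r' y')) := by
  rw [LeafStep.prob_PD_inter_v, LeafStep.prob_PD_inter_v, probQconn2_loopA h h1 h2 hr hy hr' hy',
    probQconn_x_conn2_loopA h h1 h2 h1 hr hy hr' hy', probQconn_x_conn2_loopA h h1 h2 h2 hr hy hr' hy']

omit [Fintype V] [LinearOrder R] [IsStrictOrderedRing R] in
/-- `P(PD_x ∩ {r ↔ y})` on `G − P`. -/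
lemma probPDconn1_loopA (h : IsCut ends x ↑VA ↑VB EA EB) (h1 : a₁ ∈ insert x VB)
    (h2 : a₂ ∈ insert x VB) {r y : V} (hr : r ∈ insert x VB) (hy : y ∈ insert x VB) :
    prob p (PDEvent (loopA ends EA x) a₁ a₂ x ∩ connEvent (loopA ends EA x) r y) =
      prob p (PDEvent ends a₁ a₂ x ∩ connEvent ends r y) :=
  probPDconn_loopA h h1 h2 hr hy

omit [Fintype V] in
/-- **`T₀` does not see the part.** -/
lemma T0_loopA (h : IsCut ends x ↑VA ↑VB EA EB) (ho : o ∈ insert x VB) (h1 : a₁ ∈ insert x VB)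
    (h2 : a₂ ∈ insert x VB) (hb : b ∈ insert x VB) :
    LeafStep.T0 p ends o a₁ a₂ b = LeafStep.T0 p (loopA ends EA x) o a₁ a₂ b := by
  unfold LeafStep.T0 EQbo EQo LeafStep.mU LeafStep.mUU
  rw [gap_eq_Q, gap_eq_Q, probQ_loopA h h1 h2, probQconn_loopA h h1 h2 h1 ho, probQconn_loopA h h1 h2 h2 ho,
    probQconn_loopA h h1 h2 h1 hb, probQconn_loopA h h1 h2 h2 hb, probQconn2_loopA h h1 h2 h1 ho h1 hb,
    probQconn2_loopA h h1 h2 h2 ho h2 hb, probQconn2_loopA h h1 h2 h2 ho h1 hb,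
    probQconn2_loopA h h1 h2 h1 ho h2 hb]

omit [Fintype V] in
/-- **`Gc(x)` does not see the part.** -/
lemma Gc_loopA (h : IsCut ends x ↑VA ↑VB EA EB) (ho : o ∈ insert x VB) (h1 : a₁ ∈ insert x VB)
    (h2 : a₂ ∈ insert x VB) (hb : b ∈ insert x VB) :
    Gc p ends o a₁ a₂ x b = Gc p (loopA ends EA x) o a₁ a₂ x b := by
  unfold Gc DEF EQbo EQb3 EQb3o EQo EQ3 EQ3o PDb PDbo Do
  rw [gap_eq_Q, gap_eq_Q]
  simp only [LeafStep.prob_T'_inter_v, LeafStep.prob_T'_v]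
  simp only [probQ_loopA h, probPD_loopA h, probQconn_loopA h, probQconn2_loopA h,
    probQconn_x_conn2_loopA h, probPDconn_loopA h, probPDconn2_loopA h, ho, h1, h2, hb,
    Finset.mem_insert_self]

omit [Fintype V] in
/-- **`R½(x)` does not see the part.** -/
lemma Rhalf_loopA (h : IsCut ends x ↑VA ↑VB EA EB) (ho : o ∈ insert x VB) (h1 : a₁ ∈ insert x VB)
    (h2 : a₂ ∈ insert x VB) (hb : b ∈ insert x VB) :
    LeafStep.Rhalf p ends o a₁ a₂ x b = LeafStep.Rhalf p (loopA ends EA x) o a₁ a₂ x b := by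
  unfold LeafStep.Rhalf LeafStep.T0 LeafStep.Gc1 EQbo EQb3 EQb3o EQo EQ3 EQ3o PDb PDbo Do LeafStep.mU
    LeafStep.mUU
  rw [gap_eq_Q, gap_eq_Q]
  simp only [LeafStep.prob_T'_inter_v, LeafStep.prob_T'_v]
  simp only [probQ_loopA h, probQconn_loopA h, probQconn2_loopA h, probQconn_x_conn2_loopA h,
    probPDconn_loopA h, probPDconn2_loopA h, ho, h1, h2, hb, Finset.mem_insert_self]

omit [Fintype V] in
/-- (HCOV) at the cut vertex is the same statement on `G` and on `G − P`. -/
lemma HCov_x_loopA_iff (h : IsCut ends x ↑VA ↑VB EA EB) (ho : o ∈ insert x VB)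
    (h1 : a₁ ∈ insert x VB) (h2 : a₂ ∈ insert x VB) (hb : b ∈ insert x VB) :
    HCov p ends o a₁ a₂ x b ↔ HCov p (loopA ends EA x) o a₁ a₂ x b := by
  unfold HCov
  rw [Gc_loopA h ho h1 h2 hb]

omit [Fintype V] in
/-- Row 2′LEAF at the cut vertex is the same statement on `G` and on `G − P`. -/
lemma LeafRow_x_loopA_iff (h : IsCut ends x ↑VA ↑VB EA EB) (ho : o ∈ insert x VB)
    (h1 : a₁ ∈ insert x VB) (h2 : a₂ ∈ insert x VB) (hb : b ∈ insert x VB) :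
    LeafStep.LeafRow p ends o a₁ a₂ x b ↔ LeafStep.LeafRow p (loopA ends EA x) o a₁ a₂ x b := by
  unfold LeafStep.LeafRow
  rw [Rhalf_loopA h ho h1 h2 hb]

/-- **The induction step of p1's line across a pendant part.** (HCOV) and row 2′LEAF at the cut
vertex `x` on the smaller instance `G − P` (the part's edges looped at `x`) give (HCOV) at every
`v` of the part on `G`. -/
theorem HCov_cut_of_leafRow_loopA {v : V} (hp : IsProbVec p) (h : IsCut ends x ↑VA ↑VB EA EB)
    (hv : v ∈ VA) (ho : o ∈ insert x VB) (h1 : a₁ ∈ insert x VB) (h2 : a₂ ∈ insert x VB)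
    (hb : b ∈ insert x VB) (hx : HCov p (loopA ends EA x) o a₁ a₂ x b)
    (hrow : LeafStep.LeafRow p (loopA ends EA x) o a₁ a₂ x b) :
    HCov p ends o a₁ a₂ v b :=
  HCov_cut_of_leafRow hp h hv ho h1 h2 hb ((HCov_x_loopA_iff h ho h1 h2 hb).2 hx)
    ((LeafRow_x_loopA_iff h ho h1 h2 hb).2 hrow)

end GcLoop

end A3Fibre

end CovForm

end Summit.Ventures.PercRepro2
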